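import Summits.QuantumFields.BalabanUV.Beta.D1BFx.GaugeSandwichAbstract
import Summits.QuantumFields.BalabanUV.Beta.D1BFx.PeriodisedProjector
import Summits.QuantumFields.BalabanUV.Beta.D1BFx.StencilDictionaryTorus
import Summits.QuantumFields.BalabanUV.Beta.D1BFx.FibredPeriodisation

/-!
# `BalabanUV.Beta.D1BFx.GaugeSandwich` — road «BF-x», binder row D1, slot (K), debt X₁ (`Δ_a·Ga = δ` on `ℤ⁴` for `Ga = Kinf`), brick
# **Q3c «GAUGE SANDWICH»** of `HOME/b2b-balaban-beta-d1-p2/X1-SPEC.md` v1 §1, PART 2 (INSTANTIATION): on an5's cubic fine torus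
# `T_η = Tor (fine (m+1) (cubic 4 p))` (= an4's `Beta.Site 4 ((m+1)·p)`, by `rfl`), an5's typed gauge projector `PcT` ([B5] (1.26)∕(1.70), MASSLESS
# form) and the owner's PERIODISED MASSIVE projector `P̂ = periodise₂ ((m+1)p) (Pker m a)` (Q3b, B9 (3.25) form, read over `ℂ`) AGREE ON `1^⊥`; hence
# **`GradOp·PcT·GradOpᴴ = GradOp·P̂·GradOpᴴ`** and **`DeltaA (m+1) (cubic 4 p) aQ = Lap − GradOp·P̂·GradOpᴴ + aQ•(QvAdj·QvOp)`** — brick Q4's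
# per-volume input with NO `PcT` left, for every projector tower weight `a > 0` and every vector-averaging weight `aQ`

HOW.  PART 1 (`GaugeSandwichAbstract`, p232996) proved the sandwich for ANY Hermitian `Ph` on `T_η` with (H2) `Q′f = 0 → Ph(Δf) = 0` and (H3)
`∀ b, ∃ f, Q′f = 0 ∧ b − Ph b = Δ f` (`Δ = LapS … (m+1)`, `Q′ = QsOp`), by uniqueness of the orthogonal projection onto `Δ(ker Q′)` (NE2's
`one_sub_PcT_eq_starProjection`).  The owner's `PeriodisedProjector` (p233071) proves the three laws for `P̂` in the REAL torus vocabulary of an4∕pv23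
(`P̂ᵀ = P̂`; `P̂·L̂·λ = 0` and `(1 − P̂)v = L̂λ_v` with `Ŝλ = 0`, where `L̂ = periodise₂ lapKer`, `Ŝ = periodise₂ sameBlk`).  THIS FILE is the dictionary between
the two: §1 real-to-complex glue (`A.map ofReal` on real∕complex vectors, conjugate transpose); §2 carriers (`Tor (fine (m+1) (cubic 4 p)) = Site 4 ((m+1)p)`
and `castT = siteOf`, both `rfl`; `castT (valRep z) = z`); §3 **blocks** (`blockOf z = castT (tblk m z)` from Q2's `blockOf_castT` + B5-brick's `blk_pred_eq_blk`;
`tblk z = tblk z₀ ↔ blockOf z = blockOf z₀`; block sums `Σ_{blockOf z = y} = Σ_j ∘ bpt y`), hence **`QsOp_ofReal_eq_zero_iff : Q′λ = 0 ↔ Ŝλ = 0`** for real `λ`,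
and **the scalar Laplacian** `LapS_mulVec_ofReal : Δ λ = (m+1)²·L̂λ` (Q2's `LapS_mulVec_castT` on an5's side; on ours `Lhat_mulVec_siteOf : (L̂λ)(x̄) = δd(λ∘siteOf)(x)`
by Q1's unfold-and-regroup `sum_periodise₂_mul_of_rep` + B5-brick's `codiff₁_dz_eq_tsum_lapKer`); §4 [our object] `PhatC m a p := (Phat m a ((m+1)p)).map ofReal`
and the three laws `PhatC_conjTranspose` (H1), `PhatC_LapS_mulVec` (H2), `PhatC_decomp` (H3) (real and imaginary parts separately), then BY NAME from part 1:
**`PcT_mulVec_eq_PhatC`** (`PcT b = P̂ b` for `b ⊥ 1`), **`gauge_sandwich`**, **`DeltaA_eq_periodisedProjector`**, `DeltaA_mulVec_periodisedProjector`, and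
`PcT_GradOpH_eq_PhatC` (the rewrite for Q2's `DeltaA_mulVec_castT` middle term).

HONEST FRAMING (cell contract, verbatim): «discharging `BetaPertH` makes Bałaban's UV stability UNCONDITIONAL — a real constructive-QFT
result; it is NOT the continuum limit and NOT the Clay problem.»  HONEST DEPENDENCY (verbatim): «continuum YM on T⁴ ⇐ BetaPertH ∧ nine
spine estimates (0/9 proved); BetaPertH ⇐ (D1) ∧ (D4) ∧ CAP+tail; G-an2-4 gates asym, D1 and NE2/3/4.»  [folklore] finite bookkeeping between three typists'
conventions over LANDED modules (an5 `B5Value126`∕`B5DeltaA169`∕`B5Block118`, NE2 `VariationalVectorGaugeSliceB5`, an4 `EntrywiseVolumeLimit`, pv23 `RProjector`,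
the owner's `PeriodisedKernels`∕`PeriodisedProjector`, Q2's `StencilDictionaryTorus`, Q1's `FibredPeriodisation`, part 1), all USED BY NAME, nothing re-proved; one
[our object] data def (`PhatC`) and one `NeZero ((m+1)·p)` instance; no `Prop` is minted, nothing is cited, no wall binder is instantiated; 0 sorry.  NOT D1,
NOT BetaPertH, NOT summit progress.  ABSOLUTE RULE (cell, verbatim): «No internally-minted statement may enter as a cited fact. Every hypothesis is either
kernel-proved in this package or a verbatim quotation of a PUBLISHED theorem with page reference. The manuscript(s) under audit are NOT citable for their own
disputed steps — they are the thing under adjudication; programme-internal (2001/route/tribunal) claims are never citable.»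
Provenance: D1 formalisation swarm, unit `b2b-balaban-beta-d1-formalise-leaf-03` (gen 7), claim «X1-Q3c» part 2, 2026-08-20.
-/

noncomputable section

namespace Summit.QuantumFields.BalabanUV.Beta.D1BFx.GaugeSandwich

open Finset Matrix
open scoped BigOperators Matrix ComplexConjugate
open Literature.MathematicalPhysics.QuantumFieldTheory.Balaban1983to89
open Literature.MathematicalPhysics.QuantumFieldTheory.Balaban1983to89.Beta
open B5Prop11Plancherel (Tor fine)
open B5Prop11Lower (Lap)
open B5Action121 (GradOp LapS)
open B5Block118 (QvOp QsOp QsOp_mulVec bpt)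
open B5Blocks16 (blockOf blockOf_bpt bpt_bijective)
open B5DeltaA169 (QvAdj DeltaA)
open B5Value126 (PcT)
open VectorTails (castT)
open FreeLegDictionary (cubic)
open AffineAveraging (dz codiff₁)
open AveragingContours (blk)
open B6QGQLower276 (X lapKer sameBlk)
open Summit.QuantumFields.BalabanUV.Beta.D1BFx.PeriodisedKernels (valRep siteOf_valRep tblk tblk_nonneg tblk_lt isPeriodic₂_lapKer rowBound_lapKer)
open Summit.QuantumFields.BalabanUV.Beta.D1BFx.PeriodisedProjector (Phat Lhat Shat Ghat Phat_apply Lhat_apply Shat_apply Phat_transpose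
  Phat_Lhat_mulVec Rhat_mulVec_eq_Lhat Shat_mulVec_eq_zero_iff)
open Summit.QuantumFields.BalabanUV.Beta.D1BFx.StencilDictionaryTorus (liftT0 liftT0_apply LapS_mulVec_castT blockOf_castT)
open Summit.QuantumFields.BalabanUV.Beta.D1BFx.TowerEquationForms (codiff₁_dz_eq_tsum_lapKer blk_pred_eq_blk)
open Summit.QuantumFields.BalabanUV.Beta.D1BFx.FibredPeriodisation (sum_periodise₂_mul_of_rep)
open Summit.QuantumFields.BalabanUV.Beta.D1BFx.GaugeSandwichAbstract (gauge_sandwich_of_laws DeltaA_eq_of_laws PcT_mulVec_eq_of_laws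
  DeltaA_mulVec_of_laws)

/-! ## §1 Real-to-complex glue for torus matrices -/

section Glue

variable {ι : Type*} [Fintype ι]

/-- [folklore] A real matrix read over `ℂ` acts on a real vector read over `ℂ` as the real action read over `ℂ`. -/
theorem map_ofReal_mulVec_ofReal (A : Matrix ι ι ℝ) (v : ι → ℝ) :
    A.map ((↑) : ℝ → ℂ) *ᵥ (fun i => (v i : ℂ)) = fun i => (((A *ᵥ v) i : ℝ) : ℂ) := by
  funext i
  simp only [Matrix.mulVec, dotProduct, Matrix.map_apply]
  push_cast
  rfl

omit [Fintype ι] in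
/-- [folklore] A complex vector is its real part plus `I` times its imaginary part. -/
theorem vec_re_add_im (f : ι → ℂ) :
    f = (fun i => ((f i).re : ℂ)) + Complex.I • (fun i => ((f i).im : ℂ)) := by
  funext i
  simp only [Pi.add_apply, Pi.smul_apply, smul_eq_mul]
  rw [mul_comm]
  exact (Complex.re_add_im (f i)).symm

/-- [folklore] … so a real matrix acts on a complex vector through its real and imaginary parts. -/
theorem map_ofReal_mulVec (A : Matrix ι ι ℝ) (f : ι → ℂ) :
    A.map ((↑) : ℝ → ℂ) *ᵥ f
      = (fun i => (((A *ᵥ fun j => (f j).re) i : ℝ) : ℂ)) + Complex.I • (fun i => (((A *ᵥ fun j => (f j).im) i : ℝ) : ℂ)) := by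
  conv_lhs => rw [vec_re_add_im f]
  rw [Matrix.mulVec_add, Matrix.mulVec_smul, map_ofReal_mulVec_ofReal, map_ofReal_mulVec_ofReal]

omit [Fintype ι] in
/-- [folklore] The conjugate transpose of a real matrix read over `ℂ` is its transpose read over `ℂ`. -/
theorem conjTranspose_map_ofReal (A : Matrix ι ι ℝ) : (A.map ((↑) : ℝ → ℂ))ᴴ = (Aᵀ).map ((↑) : ℝ → ℂ) := by
  ext i j
  simp [Matrix.conjTranspose_apply, Matrix.map_apply, Complex.conj_ofReal]

end Glue

/-! ## §2 The carriers: an5's fine torus `Tor (fine (m+1) (cubic 4 p))` IS an4's `Site 4 ((m+1)·p)` -/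

section Carrier

variable (m p : ℕ) [NeZero p]

/-- [folklore] The side `(m+1)·p` of the cubic fine torus is non-zero (so `Beta.Site 4 ((m+1)·p)` carries an4's `periodise₂`). -/
instance neZero_succ_mul : NeZero ((m + 1) * p) := ⟨Nat.mul_ne_zero (Nat.succ_ne_zero m) (NeZero.ne p)⟩

omit [NeZero p] in
/-- [folklore] The two typists' fine tori are the same type (`fine`, `cubic`, `Tor`, `Site` are abbreviations). -/
theorem tor_eq_site : Tor (fine (m + 1) (cubic 4 p)) = Site 4 ((m + 1) * p) := rfl

omit [NeZero p] in
/-- [folklore] an5's reduction `castT` on the cubic fine torus IS an4's `siteOf`. -/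
theorem castT_eq_siteOf (x : X 4) : castT (fine (m + 1) (cubic 4 p)) x = siteOf 4 ((m + 1) * p) x := rfl

/-- [folklore] Every fine torus point is the reduction of its canonical representative (owner's `valRep`). -/
theorem castT_valRep (z : Tor (fine (m + 1) (cubic 4 p))) :
    castT (fine (m + 1) (cubic 4 p)) (valRep (s := (m + 1) * p) z) = z :=
  siteOf_valRep (s := (m + 1) * p) z

end Carrier

/-! ## §3 The dictionary: blocks, block sums, the scalar Laplacian -/

section Dictionary

variable (m p : ℕ) [NeZero p]

/-- [folklore] an5's `blockOf` of a fine torus point is the reduction of pv23's block `tblk` of its canonical representative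
(Q2's `blockOf_castT` + the owner's `blk_pred_eq_blk`). -/
theorem blockOf_eq_castT_tblk (z : Tor (fine (m + 1) (cubic 4 p))) :
    blockOf (m + 1) (cubic 4 p) z = castT (cubic 4 p) (tblk m (s := (m + 1) * p) z) := by
  have h := blk_pred_eq_blk (n := m + 1) (valRep (s := (m + 1) * p) z)
  rw [Nat.add_sub_cancel] at h
  conv_lhs => rw [← castT_valRep m p z]
  rw [blockOf_castT, ← h]
  rfl

/-- [folklore] Two fine torus points have the same pv23 block iff they have the same an5 block (`0 ≤ tblk < p` coordinatewise). -/
theorem tblk_eq_iff_blockOf_eq (z z₀ : Tor (fine (m + 1) (cubic 4 p))) :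
    tblk m (s := (m + 1) * p) z = tblk m (s := (m + 1) * p) z₀ ↔
      blockOf (m + 1) (cubic 4 p) z = blockOf (m + 1) (cubic 4 p) z₀ := by
  rw [blockOf_eq_castT_tblk, blockOf_eq_castT_tblk]
  constructor
  · intro h; rw [h]
  · intro h
    funext i
    have hi := congrFun h i
    change ((tblk m (s := (m + 1) * p) z i : ℤ) : ZMod p) = ((tblk m (s := (m + 1) * p) z₀ i : ℤ) : ZMod p) at hi
    have hdvd := (ZMod.intCast_eq_intCast_iff_dvd_sub _ _ _).mp hi
    have h0 := tblk_nonneg m (s := (m + 1) * p) z i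
    have h0' := tblk_nonneg m (s := (m + 1) * p) z₀ i
    have h1 := tblk_lt m (s := (m + 1) * p) rfl z i
    have h1' := tblk_lt m (s := (m + 1) * p) rfl z₀ i
    have hz := Int.eq_zero_of_abs_lt_dvd hdvd (abs_lt.mpr ⟨by linarith, by linarith⟩)
    linarith

/-- [folklore] The fine torus points of an5's block `y` are exactly the `bpt y j`. -/
theorem filter_blockOf_eq (y : Tor (cubic 4 p)) :
    Finset.univ.filter (fun z : Tor (fine (m + 1) (cubic 4 p)) => blockOf (m + 1) (cubic 4 p) z = y)
      = Finset.univ.image (fun j : Fin 4 → Fin (m + 1) => bpt (m + 1) (cubic 4 p) y j) := by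
  ext z
  simp only [Finset.mem_filter, Finset.mem_univ, true_and, Finset.mem_image]
  constructor
  · intro hz
    obtain ⟨⟨y', j⟩, hyj⟩ := (bpt_bijective (m + 1) (cubic 4 p)).2 z
    refine ⟨j, ?_⟩
    have hy : y' = y := by rw [← hz, ← hyj, blockOf_bpt]
    rw [← hy]
    exact hyj
  · rintro ⟨j, rfl⟩
    exact blockOf_bpt _ _ y j

/-- [folklore] Block sums over an5's block `y` are sums over the offsets `j`. -/
theorem sum_filter_blockOf {R : Type*} [AddCommMonoid R] (g : Tor (fine (m + 1) (cubic 4 p)) → R) (y : Tor (cubic 4 p)) :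
    ∑ z ∈ Finset.univ.filter (fun z => blockOf (m + 1) (cubic 4 p) z = y), g z
      = ∑ j : Fin 4 → Fin (m + 1), g (bpt (m + 1) (cubic 4 p) y j) := by
  rw [filter_blockOf_eq, Finset.sum_image]
  intro j _ j' _ h
  exact (Prod.ext_iff.mp (bpt_injective' m p y h)).2
where
  /-- injectivity of `j ↦ bpt y j` for fixed `y` (from an5's `bpt_injective`). -/
  bpt_injective' (m p : ℕ) [NeZero p] (y : Tor (cubic 4 p)) {j j' : Fin 4 → Fin (m + 1)}
      (h : bpt (m + 1) (cubic 4 p) y j = bpt (m + 1) (cubic 4 p) y j') : ((y, j) : Tor (cubic 4 p) × (Fin 4 → Fin (m + 1))) = (y, j') :=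
    B5Blocks16.bpt_injective (m + 1) (cubic 4 p) (a₁ := (y, j)) (a₂ := (y, j')) h

/-- [folklore] `Q′f = 0` iff every an5 block sum of `f` vanishes (any level, any period vector). -/
theorem QsOp_mulVec_eq_zero_iff {d n : ℕ} [NeZero n] {M : Fin d → ℕ} [∀ μ, NeZero (M μ)] (g : Tor (fine n M) → ℂ) :
    QsOp n M *ᵥ g = 0 ↔ ∀ y, ∑ j : Fin d → Fin n, g (bpt n M y j) = 0 := by
  have hn : (1 / (n : ℂ) ^ d) ≠ 0 := one_div_ne_zero (pow_ne_zero _ (by exact_mod_cast NeZero.ne n))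
  constructor
  · intro h y
    have hy := congrFun h y
    rw [QsOp_mulVec, Pi.zero_apply, mul_eq_zero] at hy
    exact hy.resolve_left hn
  · intro h
    funext y
    rw [QsOp_mulVec, h y, mul_zero, Pi.zero_apply]

/-- [folklore] `Q′f = 0` iff `Q′(re f) = 0` and `Q′(im f) = 0` (the entries of `Q′` are real). -/
theorem QsOp_mulVec_eq_zero_iff_re_im {d n : ℕ} [NeZero n] {M : Fin d → ℕ} [∀ μ, NeZero (M μ)] (g : Tor (fine n M) → ℂ) :
    QsOp n M *ᵥ g = 0 ↔
      QsOp n M *ᵥ (fun z => ((g z).re : ℂ)) = 0 ∧ QsOp n M *ᵥ (fun z => ((g z).im : ℂ)) = 0 := by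
  simp only [QsOp_mulVec_eq_zero_iff]
  constructor
  · intro h
    refine ⟨fun y => ?_, fun y => ?_⟩
    · have hy := congrArg Complex.re (h y)
      rw [Complex.re_sum, Complex.zero_re] at hy
      exact_mod_cast hy
    · have hy := congrArg Complex.im (h y)
      rw [Complex.im_sum, Complex.zero_im] at hy
      exact_mod_cast hy
  · rintro ⟨h1, h2⟩ y
    apply Complex.ext
    · rw [Complex.re_sum, Complex.zero_re]
      exact_mod_cast h1 y
    · rw [Complex.im_sum, Complex.zero_im]
      exact_mod_cast h2 y

/-- [folklore] **BLOCK-MEAN-FREE, TWO TYPISTS**: for a REAL fine-torus function, an5's `Q′λ = 0` iff the owner's `Ŝλ = 0`. -/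
theorem QsOp_ofReal_eq_zero_iff (lam : Tor (fine (m + 1) (cubic 4 p)) → ℝ) :
    QsOp (m + 1) (cubic 4 p) *ᵥ (fun z => (lam z : ℂ)) = 0 ↔ Shat m ((m + 1) * p) *ᵥ lam = 0 := by
  rw [QsOp_mulVec_eq_zero_iff, Shat_mulVec_eq_zero_iff (m := m) rfl]
  have e : ∀ z₀ : Tor (fine (m + 1) (cubic 4 p)),
      Finset.univ.filter (fun z => tblk m (s := (m + 1) * p) z = tblk m (s := (m + 1) * p) z₀)
        = Finset.univ.filter (fun z => blockOf (m + 1) (cubic 4 p) z = blockOf (m + 1) (cubic 4 p) z₀) := fun z₀ => by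
    ext z
    simp only [Finset.mem_filter, Finset.mem_univ, true_and, tblk_eq_iff_blockOf_eq]
  constructor
  · intro h z₀
    rw [e z₀, sum_filter_blockOf]
    exact_mod_cast h (blockOf (m + 1) (cubic 4 p) z₀)
  · intro h y
    have hz := h (bpt (m + 1) (cubic 4 p) y fun _ => 0)
    rw [e, blockOf_bpt, sum_filter_blockOf] at hz
    exact_mod_cast hz

/-- [folklore] an2's `δ∘d` commutes with the real-to-complex reading of a 0-form. -/
theorem codiff₁_dz_ofReal (g : X 4 → ℝ) (x : X 4) :
    codiff₁ (dz (fun w => (g w : ℂ))) x = ((codiff₁ (dz g) x : ℝ) : ℂ) := by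
  simp only [codiff₁, dz]
  push_cast
  rfl

/-- [folklore] **THE OWNER's `L̂` ACTS AS an2's `δ∘d` ON THE LIFT**: `(L̂λ)(x̄) = (δd λ♯)(x)`, `λ♯ := λ ∘ siteOf`
(Q1's unfold-and-regroup + B5 brick's `codiff₁_dz_eq_tsum_lapKer`). -/
theorem Lhat_mulVec_siteOf (lam : Site 4 ((m + 1) * p) → ℝ) (x : X 4) :
    (Lhat ((m + 1) * p) *ᵥ lam) (siteOf 4 ((m + 1) * p) x) = codiff₁ (dz (fun w => lam (siteOf 4 ((m + 1) * p) w))) x := by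
  simp only [Matrix.mulVec, dotProduct, Lhat_apply]
  rw [sum_periodise₂_mul_of_rep (isPeriodic₂_lapKer _) (fun x => (rowBound_lapKer m).summable_abs x) rfl lam,
    codiff₁_dz_eq_tsum_lapKer]

/-- [folklore] **THE SCALAR LAPLACIAN, TWO TYPISTS**: on a REAL fine-torus function read over `ℂ`, an5's `LapS … (m+1)` IS
`(m+1)² ×` the owner's `L̂` (Q2's `LapS_mulVec_castT` on an5's side, `Lhat_mulVec_siteOf` on ours). -/
theorem LapS_mulVec_ofReal (lam : Tor (fine (m + 1) (cubic 4 p)) → ℝ) :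
    LapS (fine (m + 1) (cubic 4 p)) ((m + 1 : ℕ) : ℂ) *ᵥ (fun z => (lam z : ℂ))
      = fun z => (((((m : ℝ) + 1) ^ 2 • (Lhat ((m + 1) * p) *ᵥ lam)) z : ℝ) : ℂ) := by
  funext z
  conv_lhs => rw [← castT_valRep m p z]
  rw [LapS_mulVec_castT]
  have e1 : (liftT0 (fine (m + 1) (cubic 4 p)) fun z => (lam z : ℂ)) = fun w => ((lam (siteOf 4 ((m + 1) * p) w) : ℝ) : ℂ) := rfl
  rw [e1, codiff₁_dz_ofReal, ← Lhat_mulVec_siteOf]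
  have e2 : siteOf 4 ((m + 1) * p) (valRep (s := (m + 1) * p) z) = z := siteOf_valRep (s := (m + 1) * p) z
  rw [e2, Pi.smul_apply, smul_eq_mul, Complex.conj_natCast]
  push_cast
  ring

end Dictionary

/-! ## §4 The periodised projector read over `ℂ` obeys the three laws; the sandwich; `Δ_a` with `P̂` -/

section Laws

variable (m : ℕ) (a : ℝ) (p : ℕ) [NeZero p]

/-- [our object] **`P̂` OVER `ℂ`**: the owner's periodised projector `Phat m a ((m+1)·p)` (Q3b) read as a complex matrix on an5's fine torus. -/
def PhatC : Matrix (Tor (fine (m + 1) (cubic 4 p))) (Tor (fine (m + 1) (cubic 4 p))) ℂ :=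
  (Phat m a ((m + 1) * p)).map ((↑) : ℝ → ℂ)

/-- [our object] Unfolding of `PhatC`. -/
theorem PhatC_eq : PhatC m a p = (Phat m a ((m + 1) * p)).map ((↑) : ℝ → ℂ) := rfl

variable {a}

/-- [folklore] **(H1)** `P̂ᴴ = P̂` (owner's `Phat_transpose`). -/
theorem PhatC_conjTranspose (ha : 0 < a) : (PhatC m a p)ᴴ = PhatC m a p := by
  rw [PhatC_eq, conjTranspose_map_ofReal, Phat_transpose ha rfl]

/-- [folklore] **(H2)** `P̂(Δ f) = 0` for block-mean-free `f` (owner's `Phat_Lhat_mulVec` on the real and imaginary parts). -/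
theorem PhatC_LapS_mulVec (ha : 0 < a) {f : Tor (fine (m + 1) (cubic 4 p)) → ℂ} (hf : QsOp (m + 1) (cubic 4 p) *ᵥ f = 0) :
    PhatC m a p *ᵥ (LapS (fine (m + 1) (cubic 4 p)) ((m + 1 : ℕ) : ℂ) *ᵥ f) = 0 := by
  obtain ⟨h1, h2⟩ := (QsOp_mulVec_eq_zero_iff_re_im f).mp hf
  have hR := (QsOp_ofReal_eq_zero_iff m p (fun z => (f z).re)).mp h1
  have hI := (QsOp_ofReal_eq_zero_iff m p (fun z => (f z).im)).mp h2
  have hL : LapS (fine (m + 1) (cubic 4 p)) ((m + 1 : ℕ) : ℂ) *ᵥ f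
      = (fun z => (((((m : ℝ) + 1) ^ 2 • (Lhat ((m + 1) * p) *ᵥ fun z => (f z).re)) z : ℝ) : ℂ))
        + Complex.I • (fun z => (((((m : ℝ) + 1) ^ 2 • (Lhat ((m + 1) * p) *ᵥ fun z => (f z).im)) z : ℝ) : ℂ)) := by
    conv_lhs => rw [vec_re_add_im f]
    rw [Matrix.mulVec_add, Matrix.mulVec_smul, LapS_mulVec_ofReal, LapS_mulVec_ofReal]
  have hP : ∀ lam : Tor (fine (m + 1) (cubic 4 p)) → ℝ, Shat m ((m + 1) * p) *ᵥ lam = 0 →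
      Phat m a ((m + 1) * p) *ᵥ ((((m : ℝ) + 1) ^ 2) • (Lhat ((m + 1) * p) *ᵥ lam)) = 0 := fun lam hlam => by
    rw [Matrix.mulVec_smul, Matrix.mulVec_mulVec, Phat_Lhat_mulVec ha rfl hlam, smul_zero]
  rw [hL, Matrix.mulVec_add, Matrix.mulVec_smul, PhatC_eq, map_ofReal_mulVec_ofReal, map_ofReal_mulVec_ofReal, hP _ hR, hP _ hI]
  funext z
  simp

/-- [folklore] **(H3)** every `b` decomposes: `b − P̂b = Δ f` with `Q′f = 0` (owner's `Rhat_mulVec_eq_Lhat` on the real and imaginary parts,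
`f := (m+1)⁻²·(λ_re + I·λ_im)`). -/
theorem PhatC_decomp (ha : 0 < a) (b : Tor (fine (m + 1) (cubic 4 p)) → ℂ) :
    ∃ f, QsOp (m + 1) (cubic 4 p) *ᵥ f = 0 ∧
      b - PhatC m a p *ᵥ b = LapS (fine (m + 1) (cubic 4 p)) ((m + 1 : ℕ) : ℂ) *ᵥ f := by
  obtain ⟨hSR, hLR⟩ := Rhat_mulVec_eq_Lhat (m := m) (a := a) ha (rfl : (m + 1) * p = (m + 1) * p) (fun z => (b z).re)
  obtain ⟨hSI, hLI⟩ := Rhat_mulVec_eq_Lhat (m := m) (a := a) ha (rfl : (m + 1) * p = (m + 1) * p) (fun z => (b z).im)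
  set lamR := (((m : ℝ) + 1) ^ 2) • (Ghat m a ((m + 1) * p) *ᵥ ((1 - Phat m a ((m + 1) * p)) *ᵥ fun z => (b z).re)) with hlamR
  set lamI := (((m : ℝ) + 1) ^ 2) • (Ghat m a ((m + 1) * p) *ᵥ ((1 - Phat m a ((m + 1) * p)) *ᵥ fun z => (b z).im)) with hlamI
  have hc : ((((m : ℝ) + 1) ^ 2 : ℝ) : ℂ) ≠ 0 := by exact_mod_cast (pow_ne_zero 2 (by positivity : ((m : ℝ) + 1) ≠ 0))
  refine ⟨((((m : ℝ) + 1) ^ 2 : ℝ) : ℂ)⁻¹ • ((fun z => (lamR z : ℂ)) + Complex.I • (fun z => (lamI z : ℂ))), ?_, ?_⟩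
  · rw [Matrix.mulVec_smul, Matrix.mulVec_add, Matrix.mulVec_smul, (QsOp_ofReal_eq_zero_iff m p lamR).mpr hSR,
      (QsOp_ofReal_eq_zero_iff m p lamI).mpr hSI, smul_zero, add_zero, smul_zero]
  · rw [Matrix.mulVec_smul, Matrix.mulVec_add, Matrix.mulVec_smul, LapS_mulVec_ofReal, LapS_mulVec_ofReal]
    conv_lhs => rw [vec_re_add_im b]
    rw [Matrix.mulVec_add, Matrix.mulVec_smul, PhatC_eq, map_ofReal_mulVec_ofReal, map_ofReal_mulVec_ofReal]
    have eR : ∀ z, (b z).re - (Phat m a ((m + 1) * p) *ᵥ fun z => (b z).re) z = (Lhat ((m + 1) * p) *ᵥ lamR) z := fun z => by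
      rw [← hLR]; simp [Matrix.sub_mulVec]
    have eI : ∀ z, (b z).im - (Phat m a ((m + 1) * p) *ᵥ fun z => (b z).im) z = (Lhat ((m + 1) * p) *ᵥ lamI) z := fun z => by
      rw [← hLI]; simp [Matrix.sub_mulVec]
    funext z
    simp only [Pi.add_apply, Pi.sub_apply, Pi.smul_apply, smul_eq_mul]
    rw [← eR z, ← eI z]
    push_cast
    field_simp
    ring

/-- [folklore] **ON `1^⊥`, an5's `PcT` IS THE PERIODISED MASSIVE PROJECTOR**: `PcT b = P̂ b` for `b ⊥ 1`. -/
theorem PcT_mulVec_eq_PhatC (ha : 0 < a) {b : Tor (fine (m + 1) (cubic 4 p)) → ℂ} (hb : ∑ x, b x = 0) :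
    PcT (m + 1) (cubic 4 p) ((m + 1 : ℕ) : ℂ) *ᵥ b = PhatC m a p *ᵥ b :=
  PcT_mulVec_eq_of_laws (m + 1) (cubic 4 p) (PhatC_conjTranspose m p ha) (fun _ hf => PhatC_LapS_mulVec m p ha hf)
    (PhatC_decomp m p ha) hb

/-- [folklore] **THE GAUGE SANDWICH** (X1-SPEC Q3c): `GradOp·PcT·GradOpᴴ = GradOp·P̂·GradOpᴴ` on the cubic fine torus of side `(m+1)·p`. -/
theorem gauge_sandwich (ha : 0 < a) :
    GradOp (fine (m + 1) (cubic 4 p)) ((m + 1 : ℕ) : ℂ) * PcT (m + 1) (cubic 4 p) ((m + 1 : ℕ) : ℂ)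
        * (GradOp (fine (m + 1) (cubic 4 p)) ((m + 1 : ℕ) : ℂ))ᴴ
      = GradOp (fine (m + 1) (cubic 4 p)) ((m + 1 : ℕ) : ℂ) * PhatC m a p * (GradOp (fine (m + 1) (cubic 4 p)) ((m + 1 : ℕ) : ℂ))ᴴ :=
  gauge_sandwich_of_laws (m + 1) (cubic 4 p) (PhatC_conjTranspose m p ha) (fun _ hf => PhatC_LapS_mulVec m p ha hf)
    (PhatC_decomp m p ha)

/-- [folklore] **`Δ_a` WITH THE PERIODISED PROJECTOR** (Q4's per-volume input, no `PcT` left): on the cubic fine torus of side `(m+1)·p`,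
`DeltaA (m+1) (cubic 4 p) aQ = Lap − GradOp·P̂·GradOpᴴ + aQ•(QvAdj·QvOp)` — for EVERY vector-averaging weight `aQ` and every tower weight `a > 0`
of the projector (the sandwich does not depend on `a`). -/
theorem DeltaA_eq_periodisedProjector (ha : 0 < a) (aQ : ℝ) :
    DeltaA (m + 1) (cubic 4 p) aQ
      = Lap (m + 1) (cubic 4 p) - GradOp (fine (m + 1) (cubic 4 p)) ((m + 1 : ℕ) : ℂ) * PhatC m a p
          * (GradOp (fine (m + 1) (cubic 4 p)) ((m + 1 : ℕ) : ℂ))ᴴ + (aQ : ℂ) • (QvAdj (m + 1) (cubic 4 p) * QvOp (m + 1) (cubic 4 p)) :=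
  DeltaA_eq_of_laws (m + 1) (cubic 4 p) (PhatC_conjTranspose m p ha) (fun _ hf => PhatC_LapS_mulVec m p ha hf)
    (PhatC_decomp m p ha) aQ

/-- [folklore] … applied to a vector (an5's `DeltaA_mulVec` with `P̂`). -/
theorem DeltaA_mulVec_periodisedProjector (ha : 0 < a) (aQ : ℝ) (A : Tor (fine (m + 1) (cubic 4 p)) × Fin 4 → ℂ) :
    DeltaA (m + 1) (cubic 4 p) aQ *ᵥ A
      = Lap (m + 1) (cubic 4 p) *ᵥ A
        - GradOp (fine (m + 1) (cubic 4 p)) ((m + 1 : ℕ) : ℂ) *ᵥ (PhatC m a p *ᵥ ((GradOp (fine (m + 1) (cubic 4 p)) ((m + 1 : ℕ) : ℂ))ᴴ *ᵥ A))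
        + ((aQ : ℂ) * ((m + 1 : ℕ) : ℂ) ^ 4) • ((QvOp (m + 1) (cubic 4 p))ᴴ *ᵥ (QvOp (m + 1) (cubic 4 p) *ᵥ A)) :=
  DeltaA_mulVec_of_laws (m + 1) (cubic 4 p) (PhatC_conjTranspose m p ha) (fun _ hf => PhatC_LapS_mulVec m p ha hf)
    (PhatC_decomp m p ha) aQ A

/-- [folklore] The pointwise reading for Q2's `DeltaA_mulVec_castT`: `PcT (∂* g) = P̂ (∂* g)` for every `g`. -/
theorem PcT_GradOpH_eq_PhatC (ha : 0 < a) (g : Tor (fine (m + 1) (cubic 4 p)) × Fin 4 → ℂ) :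
    PcT (m + 1) (cubic 4 p) ((m + 1 : ℕ) : ℂ) *ᵥ ((GradOp (fine (m + 1) (cubic 4 p)) ((m + 1 : ℕ) : ℂ))ᴴ *ᵥ g)
      = PhatC m a p *ᵥ ((GradOp (fine (m + 1) (cubic 4 p)) ((m + 1 : ℕ) : ℂ))ᴴ *ᵥ g) :=
  PcT_mulVec_eq_PhatC m p ha (GaugeSandwichAbstract.sum_GradOp_conjTranspose_mulVec _ g)

end Laws

end Summit.QuantumFields.BalabanUV.Beta.D1BFx.GaugeSandwich

end
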